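import Summits.QuantumFields.YangMills.Theorems.LuscherReductionOneSiteLevelsKacHeat
import Literature.Analysis.UnboundedOperators.HeatKernelFourier
import Literature.Analysis.FunctionSpaces.PlancherelL1L2
import Mathlib.Analysis.Fourier.FourierTransformDeriv
import Mathlib.Analysis.Fourier.Convolution

/-!
# INNER, flat lane (layer III): the Plancherel core on `ZM = ℝ⁹`

Support module of crux `OneSiteLevels` (route `LuscherReduction`, item stmt-QuantumFields-20007), FLAT lane of the
registered v12 stub `stub_flatKacAL1` (STUB-PLAN rev 3 rows III.F1–F4, used for the span bound III.8 where an `O(t)` deficit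
is mandatory).  Mathlib's Fourier integral `𝓕 f ξ = ∫ 𝐞(−⟪v,ξ⟫) f v` of the complexification `cpx φ` of a real function:

* `l2_eq_fourier`: `∫ φ² = ∫ ‖𝓕 (cpx φ)‖²` for `φ ∈ L¹ ∩ L²` (tree Plancherel `integral_norm_sq_fourierIntegral_eq`);
* `fourier_cpx_heatSmooth`: `𝓕 (cpx (P_s φ)) = heatSymbol (s/2) · 𝓕 (cpx φ)` (convolution theorem + the toolkit's
  `fourierIntegral_heatKernel_holds`), so `‖𝓕(cpx(P_{t/2}φ))‖² = e^{−2π²t‖ξ‖²} ‖𝓕(cpx φ)‖²`;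
* `fourier_cpx_pderiv`: `𝓕 (cpx (∂_p φ)) ξ = (2πi ξ_p) 𝓕 (cpx φ) ξ` for `C¹` `φ` with `φ, Dφ ∈ L¹` (Mathlib `Real.fourier_fderiv`);
  hence `½ Σ_p ∫ (∂_p φ)² = ∫ 2π²‖ξ‖² ‖𝓕(cpx φ)‖²` (`half_integral_sum_pderiv_sq_eq_fourier`).
* linearity of `𝓕` on integrable functions (`fourier_cpx_add/sub/smul/sum`).

Real analysis only ([folklore]); NOT the stub; femto rung R2b1; NOT a claim about the gap.
-/

set_option autoImplicit false

noncomputable section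

open MeasureTheory Filter Topology Real Complex FourierTransform
open scoped RealInnerProductSpace Convolution
open Literature.Analysis.OperatorTheory.YMMatrixModel

namespace Summit.QuantumFields.YangMills.Theorems.FemtoTransferGap

/-- Complexification of a real function on `ZM` (Mathlib's `𝓕` is `ℂ`-valued). [folklore] -/
def cpx (φ : ZM → ℝ) : ZM → ℂ := fun x => (φ x : ℂ)

/-- `cpx` unfolded. [folklore] -/
@[simp] theorem cpx_apply (φ : ZM → ℝ) (x : ZM) : cpx φ x = (φ x : ℂ) := rfl

/-- `‖cpx φ x‖ = |φ x|`. [folklore] -/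
theorem norm_cpx (φ : ZM → ℝ) (x : ZM) : ‖cpx φ x‖ = |φ x| := by
  rw [cpx_apply, Complex.norm_real, Real.norm_eq_abs]

/-- `cpx φ` is integrable iff `φ` is; forward direction. [folklore] -/
theorem integrable_cpx {φ : ZM → ℝ} (hi : Integrable φ) : Integrable (cpx φ) := hi.ofReal

/-- `cpx φ ∈ L²` for `φ² ∈ L¹`. [folklore] -/
theorem memLp_two_cpx {φ : ZM → ℝ} (hm : AEStronglyMeasurable φ volume) (h2 : Integrable fun x => φ x ^ 2) :
    MemLp (cpx φ) 2 volume := by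
  refine (memLp_two_iff_integrable_sq_norm (Complex.continuous_ofReal.comp_aestronglyMeasurable hm)).2 ?_
  exact h2.congr (Eventually.of_forall fun x => by simp only [Complex.norm_real, Real.norm_eq_abs, sq_abs])

/-- **Plancherel glue**: `∫ φ² = ∫ ‖𝓕(cpx φ)‖²` for `φ ∈ L¹` with `φ² ∈ L¹`. [folklore] -/
theorem l2_eq_fourier {φ : ZM → ℝ} (hi : Integrable φ) (h2 : Integrable fun x => φ x ^ 2) :
    ∫ x, φ x ^ 2 = ∫ ξ, ‖𝓕 (cpx φ) ξ‖ ^ 2 := by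
  rw [Literature.Analysis.FunctionSpaces.integral_norm_sq_fourierIntegral_eq (integrable_cpx hi)
    (memLp_two_cpx hi.aestronglyMeasurable h2)]
  exact integral_congr_ae (Eventually.of_forall fun x => by simp only [cpx_apply, Complex.norm_real, Real.norm_eq_abs, sq_abs])

/-- `𝓕(cpx φ) ∈ L²` and `‖𝓕(cpx φ)‖² ∈ L¹` for `φ ∈ L¹ ∩ L²`. [folklore] -/
theorem integrable_norm_sq_fourier_cpx {φ : ZM → ℝ} (hi : Integrable φ) (h2 : Integrable fun x => φ x ^ 2) :
    Integrable fun ξ => ‖𝓕 (cpx φ) ξ‖ ^ 2 := by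
  have h := Literature.Analysis.FunctionSpaces.memLp_two_fourierIntegral (integrable_cpx hi)
    (memLp_two_cpx hi.aestronglyMeasurable h2)
  exact (memLp_two_iff_integrable_sq_norm h.1).1 h

/-! ### Linearity of `𝓕` on integrable functions -/

/-- `𝓕 (f + g) = 𝓕 f + 𝓕 g` pointwise, for integrable `f, g : ZM → ℂ`. [folklore] -/
theorem fourier_add_apply {f g : ZM → ℂ} (hf : Integrable f) (hg : Integrable g) (ξ : ZM) :
    𝓕 (f + g) ξ = 𝓕 f ξ + 𝓕 g ξ := by
  simp only [Real.fourier_eq, Pi.add_apply, smul_add]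
  exact integral_add ((Real.fourierIntegral_convergent_iff ξ).2 hf) ((Real.fourierIntegral_convergent_iff ξ).2 hg)

/-- `𝓕 (c • f) = c • 𝓕 f` pointwise (`c : ℂ`). [folklore] -/
theorem fourier_const_mul_apply (c : ℂ) (f : ZM → ℂ) (ξ : ZM) :
    𝓕 (fun x => c * f x) ξ = c * 𝓕 f ξ := by
  simp only [Real.fourier_eq]
  rw [← integral_const_mul]
  exact integral_congr_ae (Eventually.of_forall fun v => by
    simp only [Circle.smul_def, smul_eq_mul]; ring)

/-- `𝓕 (f − g) = 𝓕 f − 𝓕 g` pointwise, for integrable `f, g`. [folklore] -/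
theorem fourier_sub_apply {f g : ZM → ℂ} (hf : Integrable f) (hg : Integrable g) (ξ : ZM) :
    𝓕 (f - g) ξ = 𝓕 f ξ - 𝓕 g ξ := by
  simp only [Real.fourier_eq, Pi.sub_apply, smul_sub]
  exact integral_sub ((Real.fourierIntegral_convergent_iff ξ).2 hf) ((Real.fourierIntegral_convergent_iff ξ).2 hg)

/-- `𝓕 (Σ_i f_i) = Σ_i 𝓕 f_i` pointwise, for integrable `f_i`. [folklore] -/
theorem fourier_sum_apply {ι : Type*} (s : Finset ι) {f : ι → ZM → ℂ} (hf : ∀ i, Integrable (f i)) (ξ : ZM) :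
    𝓕 (fun x => ∑ i ∈ s, f i x) ξ = ∑ i ∈ s, 𝓕 (f i) ξ := by
  simp only [Real.fourier_eq, Finset.smul_sum]
  exact integral_finsetSum _ fun i _ => (Real.fourierIntegral_convergent_iff ξ).2 (hf i)

/-! ### The heat multiplier -/

/-- The complexified heat smoothing is the complex convolution of the complexified kernel and datum. [folklore] -/
theorem cpx_heatSmooth_eq_convolution {s : ℝ} (φ : ZM → ℝ) :
    cpx (heatSmooth s φ) =
      (fun x => ((Literature.Analysis.UnboundedOperators.heatKernel (s / 2) x : ℝ) : ℂ)) ⋆[ContinuousLinearMap.mul ℂ ℂ, volume]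
        cpx φ := by
  funext x
  rw [cpx_apply, heatSmooth_eq_heatExtension, Literature.Analysis.UnboundedOperators.heatExtension_apply, convolution_def]
  simp only [smul_eq_mul, ContinuousLinearMap.mul_apply', cpx_apply]
  rw [← integral_complex_ofReal]
  exact integral_congr_ae (Eventually.of_forall fun y => by push_cast; ring)

/-- **III.F1 — the heat multiplier**: `𝓕 (cpx (P_s φ)) ξ = heatSymbol (s/2) ξ · 𝓕 (cpx φ) ξ` for `φ ∈ L¹`, `0 < s`
(convolution theorem; `𝓕 G_τ = heatSymbol τ`). [folklore] -/
theorem fourier_cpx_heatSmooth {s : ℝ} (hs : 0 < s) {φ : ZM → ℝ} (hi : Integrable φ) (ξ : ZM) :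
    𝓕 (cpx (heatSmooth s φ)) ξ =
      ((Literature.Analysis.UnboundedOperators.heatSymbol (s / 2) ξ : ℝ) : ℂ) * 𝓕 (cpx φ) ξ := by
  have hK : Integrable fun x : ZM => ((Literature.Analysis.UnboundedOperators.heatKernel (s / 2) x : ℝ) : ℂ) :=
    (Literature.Analysis.UnboundedOperators.integrable_heatKernel_holds (E := ZM) (half_pos hs)).ofReal
  rw [cpx_heatSmooth_eq_convolution, Real.fourier_mul_convolution_eq hK (integrable_cpx hi) ξ,
    Literature.Analysis.UnboundedOperators.fourierIntegral_heatKernel_holds (half_pos hs) ξ]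

/-- The squared multiplier: `heatSymbol (t/4) ξ ^ 2 = exp (−2π² t ‖ξ‖²)`. [folklore] -/
theorem heatSymbol_quarter_sq (t : ℝ) (ξ : ZM) :
    Literature.Analysis.UnboundedOperators.heatSymbol (t / 4) ξ ^ 2 = Real.exp (-(2 * π ^ 2 * t * ‖ξ‖ ^ 2)) := by
  unfold Literature.Analysis.UnboundedOperators.heatSymbol
  rw [sq, ← Real.exp_add]
  congr 1
  ring

/-- `‖𝓕(cpx(P_{t/2} φ)) ξ‖² = e^{−2π² t‖ξ‖²} ‖𝓕(cpx φ) ξ‖²` for `φ ∈ L¹`. [folklore] -/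
theorem norm_sq_fourier_cpx_heatSmooth_half {t : ℝ} (ht : 0 < t) {φ : ZM → ℝ} (hi : Integrable φ) (ξ : ZM) :
    ‖𝓕 (cpx (heatSmooth (t / 2) φ)) ξ‖ ^ 2 = Real.exp (-(2 * π ^ 2 * t * ‖ξ‖ ^ 2)) * ‖𝓕 (cpx φ) ξ‖ ^ 2 := by
  rw [fourier_cpx_heatSmooth (half_pos ht) hi ξ, norm_mul, mul_pow, Complex.norm_real, Real.norm_eq_abs, sq_abs,
    show t / 2 / 2 = t / 4 by ring, heatSymbol_quarter_sq]

/-! ### The derivative rule -/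

/-- `cpx φ` is `C^n` when `φ` is. [folklore] -/
theorem contDiff_cpx {φ : ZM → ℝ} {n : ℕ∞} (hφ : ContDiff ℝ n φ) : ContDiff ℝ n (cpx φ) :=
  ofRealCLM.contDiff.comp hφ

/-- The derivative of the complexification: `D(cpx φ)(x) v = (Dφ(x) v : ℂ)`. [folklore] -/
theorem fderiv_cpx_apply {φ : ZM → ℝ} (hφ : Differentiable ℝ φ) (x v : ZM) :
    fderiv ℝ (cpx φ) x v = ((fderiv ℝ φ x v : ℝ) : ℂ) := by
  have h : HasFDerivAt (cpx φ) (ofRealCLM.comp (fderiv ℝ φ x)) x :=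
    ofRealCLM.hasFDerivAt.comp x (hφ x).hasFDerivAt
  rw [h.fderiv]
  rfl

/-- `‖D(cpx φ)(x)‖ ≤ ‖Dφ(x)‖`. [folklore] -/
theorem norm_fderiv_cpx_le {φ : ZM → ℝ} (hφ : Differentiable ℝ φ) (x : ZM) :
    ‖fderiv ℝ (cpx φ) x‖ ≤ ‖fderiv ℝ φ x‖ := by
  have h : HasFDerivAt (cpx φ) (ofRealCLM.comp (fderiv ℝ φ x)) x :=
    ofRealCLM.hasFDerivAt.comp x (hφ x).hasFDerivAt
  rw [h.fderiv]
  refine (ContinuousLinearMap.opNorm_comp_le _ _).trans ?_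
  rw [Complex.ofRealCLM_norm, one_mul]

/-- **III.F3 — the derivative rule**: for `C¹` `φ` with `φ ∈ L¹` and `‖Dφ‖ ∈ L¹`,
`𝓕 (cpx (∂_p φ)) ξ = (2πi ξ_p) · 𝓕 (cpx φ) ξ`. [folklore] -/
theorem fourier_cpx_pderiv {φ : ZM → ℝ} (hφ : ContDiff ℝ 1 φ) (hi : Integrable φ)
    (hD : Integrable fun x => ‖fderiv ℝ φ x‖) (p : Fin 3 × Fin 3) (ξ : ZM) :
    𝓕 (cpx (pderiv p φ)) ξ = (2 * π * I * ((ξ p : ℝ) : ℂ)) * 𝓕 (cpx φ) ξ := by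
  have hdφ : Differentiable ℝ φ := hφ.differentiable one_ne_zero
  have hdc : Differentiable ℝ (cpx φ) := (contDiff_cpx hφ).differentiable one_ne_zero
  -- integrability of the (CLM-valued) derivative of `cpx φ`
  have hDc : Integrable (fderiv ℝ (cpx φ)) := by
    refine hD.mono' ((contDiff_cpx hφ).continuous_fderiv one_ne_zero).aestronglyMeasurable
      (Eventually.of_forall fun x => ?_)
    simpa only [norm_norm] using norm_fderiv_cpx_le hdφ x
  -- `𝓕 (∂_p cpx φ) = 𝓕 (D cpx φ) · e_p`
  have e1 : cpx (pderiv p φ) = fun x => fderiv ℝ (cpx φ) x (unitDir p) := by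
    funext x; rw [cpx_apply, pderiv, fderiv_cpx_apply hdφ]
  rw [e1, ← Real.fourier_continuousLinearMap_apply hDc, Real.fourier_fderiv (integrable_cpx hi) hdc hDc,
    VectorFourier.fourierSMulRight_apply]
  have hinner : ⟪ξ, unitDir p⟫ = ξ p := by
    rw [unitDir, EuclideanSpace.inner_single_right]; simp
  have h2 : ((innerSL ℝ) ξ) (unitDir p) = ξ p := by rw [← hinner]; rfl
  have h3 : ((-innerSL ℝ : ZM →L[ℝ] ZM →L[ℝ] ℝ) ξ) (unitDir p) = -(ξ p) := by
    rw [← h2]; simp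
  rw [h3]
  simp only [Complex.real_smul, smul_eq_mul]
  push_cast
  ring

/-- `Σ_p ξ_p² = ‖ξ‖²` on `ZM`. [folklore] -/
theorem sum_sq_coord (ξ : ZM) : ∑ p, ξ p ^ 2 = ‖ξ‖ ^ 2 := by
  rw [EuclideanSpace.norm_sq_eq]
  exact Finset.sum_congr rfl fun p _ => by rw [Real.norm_eq_abs, sq_abs]

/-- `Σ_p ‖𝓕(cpx ∂_pφ) ξ‖² = 4π²‖ξ‖² ‖𝓕(cpx φ) ξ‖²`. [folklore] -/
theorem sum_norm_sq_fourier_cpx_pderiv {φ : ZM → ℝ} (hφ : ContDiff ℝ 1 φ) (hi : Integrable φ)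
    (hD : Integrable fun x => ‖fderiv ℝ φ x‖) (ξ : ZM) :
    ∑ p, ‖𝓕 (cpx (pderiv p φ)) ξ‖ ^ 2 = 4 * π ^ 2 * ‖ξ‖ ^ 2 * ‖𝓕 (cpx φ) ξ‖ ^ 2 := by
  have hnorm : ∀ p, ‖(2 * π * I * ((ξ p : ℝ) : ℂ))‖ ^ 2 = 4 * π ^ 2 * ξ p ^ 2 := fun p => by
    have e : (2 * π * I * ((ξ p : ℝ) : ℂ)) = ((2 * π * ξ p : ℝ) : ℂ) * I := by push_cast; ring
    rw [e, norm_mul, Complex.norm_I, mul_one, Complex.norm_real, Real.norm_eq_abs, sq_abs]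
    ring
  have hp : ∀ p, ‖𝓕 (cpx (pderiv p φ)) ξ‖ ^ 2 = 4 * π ^ 2 * ξ p ^ 2 * ‖𝓕 (cpx φ) ξ‖ ^ 2 := fun p => by
    rw [fourier_cpx_pderiv hφ hi hD, norm_mul, mul_pow, hnorm p]
  simp_rw [hp]
  rw [← sum_sq_coord, Finset.mul_sum, Finset.sum_mul]

/-- **Dirichlet form on the Fourier side**: for `C¹` `φ` with `φ, ‖Dφ‖ ∈ L¹` and `∂_pφ ∈ L²`,
`½ Σ_p ∫ (∂_p φ)² = ∫ 2π²‖ξ‖² ‖𝓕(cpx φ) ξ‖²`, and the right integrand is integrable. [folklore] -/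
theorem half_sum_integral_pderiv_sq_eq_fourier {φ : ZM → ℝ} (hφ : ContDiff ℝ 1 φ) (hi : Integrable φ)
    (hD : Integrable fun x => ‖fderiv ℝ φ x‖) (hDi : ∀ p, Integrable (pderiv p φ))
    (hD2 : ∀ p, Integrable fun x => pderiv p φ x ^ 2) :
    Integrable (fun ξ => 2 * π ^ 2 * ‖ξ‖ ^ 2 * ‖𝓕 (cpx φ) ξ‖ ^ 2) ∧
      (1 / 2 : ℝ) * ∑ p, ∫ x, pderiv p φ x ^ 2 = ∫ ξ, 2 * π ^ 2 * ‖ξ‖ ^ 2 * ‖𝓕 (cpx φ) ξ‖ ^ 2 := by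
  have hP : ∀ p, ∫ x, pderiv p φ x ^ 2 = ∫ ξ, ‖𝓕 (cpx (pderiv p φ)) ξ‖ ^ 2 := fun p => l2_eq_fourier (hDi p) (hD2 p)
  have hI : ∀ p, Integrable fun ξ => ‖𝓕 (cpx (pderiv p φ)) ξ‖ ^ 2 := fun p => integrable_norm_sq_fourier_cpx (hDi p) (hD2 p)
  have hsum : Integrable fun ξ => ∑ p, ‖𝓕 (cpx (pderiv p φ)) ξ‖ ^ 2 := integrable_finsetSum _ fun p _ => hI p
  have e : (fun ξ => 2 * π ^ 2 * ‖ξ‖ ^ 2 * ‖𝓕 (cpx φ) ξ‖ ^ 2) =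
      fun ξ => (1 / 2 : ℝ) * ∑ p, ‖𝓕 (cpx (pderiv p φ)) ξ‖ ^ 2 := by
    funext ξ; rw [sum_norm_sq_fourier_cpx_pderiv hφ hi hD]; ring
  refine ⟨by rw [e]; exact hsum.const_mul _, ?_⟩
  rw [e, integral_const_mul, integral_finsetSum _ fun p _ => hI p]
  congr 1
  exact Finset.sum_congr rfl fun p _ => hP p

end Summit.QuantumFields.YangMills.Theorems.FemtoTransferGap

end
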